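import Literature.MathematicalPhysics.QuantumFieldTheory.Balaban1983to89.B9Eq3152ThirdWordGradRowOfHessianRows
import Literature.MathematicalPhysics.QuantumFieldTheory.Balaban1983to89.B9Eq344GreenPrimeRowsOnDecayingData
import Literature.MathematicalPhysics.QuantumFieldTheory.Balaban1983to89.B9Eq3152RkStepHolderLetterExplicit
import Literature.MathematicalPhysics.QuantumFieldTheory.Balaban1983to89.B9Eq3152StoreyHOfHLb

/-!
# `Balaban1983to89.B9Eq3152StoreyHClosedOnModel` — T. Bałaban, *Propagators for lattice gauge theories in a background field*, Commun. Math. Phys. **99** (1985) 389–434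
# [Balaban1985BackgroundPropagators] Thm 3.13 p. 426 with Thm 3.1 (3.42)–(3.44) pp. 397–398, (3.152)–(3.153) p. 426, (3.36) p. 396; [B11] T. Bałaban, *The variational
# problem and background fields in renormalization group method for lattice gauge theories*, Commun. Math. Phys. **102** (1985) 277–309, (117) p. 296: **STOREY H CLOSED ON THE
# MODEL — the (117) socket `‖toCLM115 ∇_U 𝔊̃_k‖ ≤ max(w̄₀B, w̄₁B)·w̲⁻¹` for the FULL `𝔊̃_k`, with NO displayed letter.**  The four first-order rows (HR) of this lineage's junction
# `B9Eq3152ThirdWordGradRowOfHessianRows` are DISCHARGED: (R1)∕(R2) — value and η-scale `½`-Hölder rows of `ω = R_kG′_kD*_Uf` — by gen 93∕94's closed chain with the exponent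
# kept explicit (`B9Eq343LocalHolderFlat.exists_localHolder_flat` → `flatWindowLetter_of_localHolder` → `exists_holderRow_GpOfUk_covDiv_of_flatWindow (β := ½)`,
# `exists_valueRow_GpOfUk_covDiv`, the `R_k`-step `B9Eq3152RkStepHolderLetterExplicit` with `HX_holds`); (R3)∕(R4) — value and covariant-gradient rows of `u = G′_kω` — by
# `B9Eq344GreenPrimeRowsOnDecayingData`.  Then `H3` by the junction (whose analytic input is the CLOSED covariant Hessian row `B9Eq344CovariantHessianRowTower`, built on the
# (3.44)-letter `B9Eq344ResolventGradientRowTower`, the discrete Campanato `C^{1,½}` road `B4Eq19Lattice*`, and the commutator bound `B9Eq3117CommutatorBound` — where (3.36)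
# enters), and the socket by G-3 `B11Eq117FrakGkPiTransformationNorm.exists_norm_toCLM115_frakGkPi_le_of_thirdWord`.  NE9 crux-team LEAF PROVER 01, gen 95.

statement-level skeleton of published theorems with citation tags; proofs where landed; nothing here is a claim about the Yang–Mills mass gap

CITATION HEADER (lean-in-tree rule).  Audit cell `pub-balaban`, sub-cell `t4`, BINDER row NE9; filed by NE9 crux-team LEAF PROVER 01 (`b2b-balaban-t4-ne9-formalise-leaf-01`,
gen 95; bears_on: R4/N22).  Source READ first-hand (`paper:balaban1985-cmp99-background-propagators`, pp. 394–398, 419, 426; `paper:balaban1985-cmp102-variational`, p. 296).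
Every ingredient is REUSED BY NAME (see the module names above); the statements of `H3` and of the socket are HJ-2's ∕ G-3's verbatim.  Nothing printed is a hypothesis.

WHAT IS PROVED (sorry-free; proof lane — 0 `def`).
* §1 **`rows_RkGpDstar_GpOfUk_hold`** — (HR) of `B9Eq3152ThirdWordGradRowOfHessianRows` DISCHARGED on the model.
* §2 **`local_gradLetter_thirdWord_holds`** — `H3` (the third word's local slice-gradient row) with NO hypothesis beyond the cell's standing data.
* §3 **`norm_toCLM115_frakGkPi_le`** — the (117) socket for the FULL `𝔊̃_k` ON THE MODEL, no displayed letter: STOREY H of the (117) VALUE∕GRADIENT programme is CLOSED on the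
  cell's model (the junction theorems taking (HLb) — `B9Eq3152StoreyHOfHLb` etc. — remain vacuous-hypothesis statements; this file does not use them).
HONEST SCOPE.  Everything is on the cell's MODEL of [B9]∕[B11] (the (T4E) block: tower `towerP`, transporters `Ad(U)`, `laplacePrimeAk`, `laplaceAkPi`, `frakGLatticeK`); nothing
of print's Thm 3.1 ∕ 3.13 or [B11] (117) on print's objects is asserted, and the binder block's smallness data (`α ≤ α₁`, `‖J‖ ≤ j₀ ≤ j₁`, positivity witnesses, `Q_k` surjective)
are hypotheses of the socket as in G-3.  «NE9 ⇐ the named binders»; NE9 NOT PRINTED ∕ NOT PROVED; row WALLED ON A MODEL (O-NE9-1; #5 UNRULED); spine PROVED 0∕9; rung (B)+1 on a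
finite T⁴ — NOT infinite volume, NOT mass gap, NOT BetaPertH, NOT Clay.  HONEST DEPENDENCY: continuum YM on T⁴ ⇐ BetaPertH ∧ nine spine estimates (0/9 proved); BetaPertH ⇐
(D1) ∧ (D4) ∧ CAP+tail; G-an2-4 gates asym, D1 and NE2/3/4.  NEW file; nothing modified.  Net new unproved facts: 0.
-/

noncomputable section

set_option autoImplicit false

open scoped InnerProductSpace ComplexConjugate BigOperators

namespace Literature.MathematicalPhysics.QuantumFieldTheory.Balaban1983to89.B9Eq3152StoreyHClosedOnModel

open B4Sect5Torus (TSite tdist tdist_nonneg)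
open B4Sect5Proof (latticeConst latticeConst_nonneg)
open B4TorusKernel.MultiPeriod (circAbs)
open B9SectCLatticeCarrier (Bond bpos btgt unshift)
open B9Eq311L2Pairing (WL2)
open B9Eq319QprimeTorus (fineP blockCoord)
open B7Prop1Explicit (U1 Wcx boxVec)
open B11Eq103H1Complex (SiteL2K BondL2K greenK covDerivL2K covDivL2K covLaplaceSiteK G1LatticeK frakGLatticeK)
open B9Eq310DeltaPrime (plaqHolU)
open B9Eq310HessianOperator (adTransportW)
open B9Eq315QTorus (perCfg cornerSite)
open B9Eq315QTower (towerP UlevOf)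
open B9Eq316TowerFlatIsOneStep (towerP_eq_fineP_pow siteCast)
open B9Eq326OperatorTower (QprimeTowerW RofUk laplaceAk QkW)
open B9Eq3119DeltaPiTower (laplaceAkPi)
open B9Eq324DeltaPrimeATower (laplacePrimeAk GpOfUk)
open B9Eq33CovDerivVector (covGrad)
open B11Eq115Space (NegSup levWeight)
open B11Eq111FrakG (toCLM115)
open B9Eq343LocalHolderFlat (exists_localHolder_flat)
open B9Eq343FlatWindowLetterOfLocalHolder (flatWindowLetter_of_localHolder)
open B9Eq343GreenPrimeDstarHolderRowTowerOfFlatWindow (exists_holderRow_GpOfUk_covDiv_of_flatWindow)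
open B9Eq342GreenPrimeDstarValueRowTower (exists_valueRow_GpOfUk_covDiv)
open B9Eq3152StoreyHTwoHolderMembers (HX_holds)
open B9Eq3152RkStepHolderLetterExplicit (holderLetter_RkGpDstar_of_GpDstar_explicit)
open B9Eq344GreenPrimeRowsOnDecayingData (exists_rows_GpOfUk_of_decaying)
open B9Eq3152ThirdWordGradRowOfHessianRows (exists_local_gradLetter_thirdWord_of_rows)
open B11Eq117FrakGkPiTransformationNorm (exists_norm_toCLM115_frakGkPi_le_of_thirdWord)

variable {d : ℕ} (hd : 1 ≤ d) (L : ℕ) [NeZero L] (hL : 1 ≤ L) (hL3 : 3 ≤ L)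
  {𝔸 : Type*} [NormedRing 𝔸] [NormedAlgebra ℂ 𝔸] [CompleteSpace 𝔸] [NormOneClass 𝔸] [StarRing 𝔸] [NormedStarGroup 𝔸] [StarModule ℂ 𝔸]
  {W : Type*} [NormedAddCommGroup W] [InnerProductSpace ℂ W] [FiniteDimensional ℂ W] (φ : W ≃ₗ[ℂ] 𝔸)
  {Mφ Mφ' : ℝ} (hMφ : 0 ≤ Mφ) (hMφ' : 0 ≤ Mφ') (hφ : ∀ w, ‖φ w‖ ≤ Mφ * ‖w‖) (hφ' : ∀ X, ‖φ.symm X‖ ≤ Mφ' * ‖X‖) (hstar : ∀ X : 𝔸, ‖star X‖ ≤ ‖X‖)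
  {a : ℝ} (ha : 0 < a) {a' : ℝ} (ha' : 0 < a') {ϱ : ℝ} (hϱ0 : 0 ≤ ϱ) (hϱ1 : ϱ < 1)
  (τ : 𝔸 →ₗ[ℂ] ℂ) {Cτ : ℝ} (hτ : ∀ X, ‖τ X‖ ≤ Cτ * ‖X‖) (hCτ : 0 ≤ Cτ) {Mτ : ℝ} (hτm : ∀ X Y : 𝔸, ‖τ (X * Y)‖ ≤ Mτ * ‖X‖ * ‖Y‖) (hMτ : 0 ≤ Mτ)
  {ρw : ℝ} (hρw : 0 ≤ ρw)
  (hτ₁ : ∀ X : 𝔸, τ (star X) = conj (τ X)) (hτ₂ : ∀ X Y : 𝔸, τ (X * Y) = τ (Y * X)) (hφτ : ∀ X Y : 𝔸, ⟪φ.symm X, φ.symm Y⟫_ℂ = τ (star X * Y))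
  (AQ : ℝ)

/-! ## §1 The four first-order rows (HR), discharged -/

set_option maxHeartbeats 800000 in -- three ≈ 50-binder blocks
include hd hL hL3 hMφ hMφ' hφ hφ' ha ha' hϱ0 hϱ1 hτ hCτ hMτ hρw hτ₁ hτ₂ hφτ in
/-- **(HR) ON THE MODEL**: the value and η-scale `½`-Hölder rows of `ω = R_kG′_kD*_Uf` and the value and covariant-gradient rows of `u = G′_kω`, with block decay from the support
block of `f`, common constants — from gen 93∕94's CLOSED letters with the exponent `½` explicit and `B9Eq344GreenPrimeRowsOnDecayingData`.
[cite: Balaban1985BackgroundPropagators, Thm 3.1 (3.42)–(3.43), (3.47) pp.397–398, (3.25) p.394] -/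
theorem rows_RkGpDstar_GpOfUk_hold :
    ∃ αa Ba δa : ℝ, 0 < αa ∧ 0 ≤ Ba ∧ 0 < δa ∧
      ∀ (n : ℕ) (η : ℝ) (_hηL : η * (L : ℝ) ^ (n + 1) = 1) (c₀ c₁ : ℝ) [Fact (0 < c₀)] [Fact (0 < c₁)]
        (_hw : c₀ * ((L : ℝ) ^ (n + 1)) ^ d = c₁) (_hρ : |η| ^ d / c₀ ≤ ρw) (m : Fin d → ℕ) [∀ i, NeZero (m i)] (_hm : ∀ i, 1 ≤ m i)
        (U : Bond d (towerP L m (n + 1)) → 𝔸ˣ) (αU : ℕ → ℝ) (_hα0 : ∀ j, 0 ≤ αU j) (hα1 : ∀ j, αU j ≤ 1 / 64)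
        (hU1 : ∀ (j : ℕ) (x : B7Prop1Explicit.Site d) (k : Fin d), perCfg (towerP L m (j + 1)) (UlevOf L m (n + 1) U j) x k ∈ U1 𝔸)
        (hreg : ∀ (j : ℕ) (y : TSite d (towerP L m j)) (k : Fin d) (ρ' : Fin d → Fin L),
          ‖((Wcx L (perCfg (towerP L m (j + 1)) (UlevOf L m (n + 1) U j)) (cornerSite L y) k (boxVec L ρ') : 𝔸ˣ) : 𝔸) - 1‖ ≤ αU j)
        (εU : ℕ → ℝ) (_hεU : ∀ j, 0 ≤ εU j) (_hUε : ∀ (j : ℕ) (b : Bond d (towerP L m (j + 1))), ‖(UlevOf L m (n + 1) U j b : 𝔸) - 1‖ ≤ εU j)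
        (_hLb : ∀ (j : ℕ) (b : Bond d (towerP L m (j + 1))), UlevOf L m (n + 1) U j b ∈ U1 𝔸)
        (α : ℝ) (_hα : 0 ≤ α) (_hαle : α ≤ αa)
        (hUst : ∀ b, star (U b : 𝔸) = (((U b)⁻¹ : 𝔸ˣ) : 𝔸)) (_hUb : ∀ b, U b ∈ U1 𝔸) (_hUη : ∀ b, ‖(U b : 𝔸) - 1‖ ≤ α * η)
        (_hpl : ∀ p : B9SectCLatticeCarrier.Plaq d (towerP L m (n + 1)), ‖(plaqHolU U p : 𝔸) - 1‖ ≤ α * η ^ 2)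
        (_hUgrad : ∀ (x : TSite d (towerP L m (n + 1))) (μ : Fin d), ‖(U (x, μ) : 𝔸) - U (unshift μ x, μ)‖ ≤ α * η ^ 2)
        (_hRlev : ∀ (j : ℕ) (b : Bond d (towerP L m (j + 1))) (w : W), ‖adTransportW φ (UlevOf L m (n + 1) U j) b w‖ ≤ ‖w‖)
        (_hεg : ∀ j < n + 1, εU j ≤ α * ϱ ^ j) (_hAQ : ∑ j ∈ Finset.range (n + 1), αU j ≤ AQ)
        (hpos' : ∀ x : SiteL2K ℂ d (towerP L m (n + 1)) c₀ W, x ≠ 0 → 0 < RCLike.re ⟪x, laplacePrimeAk L m n φ η U a' (c₁ := c₁) x⟫_ℂ)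
        (hpos : ∀ x : BondL2K ℂ d (towerP L m (n + 1)) c₀ W, x ≠ 0 →
          0 < RCLike.re ⟪x, laplaceAk L m n φ η U hL αU hα1 hU1 hreg τ (c₀ := c₀) (c₁ := c₁) a x⟫_ℂ)
        (hposπ : ∀ x : BondL2K ℂ d (towerP L m (n + 1)) c₀ W, x ≠ 0 →
          0 < RCLike.re ⟪x, laplaceAkPi L m n φ τ η U a' hpos' hL αU hα1 hU1 hreg (c₁ := c₁) a x⟫_ℂ)
        (_hc₀ : c₀ = η ^ d)
        (_hJ : ∀ (μ : Fin d) (y : TSite d (towerP L m (n + 1))),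
          ‖B9Eq39Adjoint.J (fun μ => B9Eq33CovDerivVector.shiftEquiv μ) (fun μ y => U (y, μ)) η μ y‖ ≤ α)
        (v : TSite d m) (f : BondL2K ℂ d (towerP L m (n + 1)) c₀ W) (F : ℝ)
        (_hfv : ∀ b, blockCoord (L ^ (n + 1)) m (siteCast (towerP_eq_fineP_pow L m (n + 1)) (bpos b)) ≠ v →
          WL2.equiv ℂ (fun _ : Bond d (towerP L m (n + 1)) => c₀) W f b = 0)
        (_hfF : ∀ b, ‖WL2.equiv ℂ (fun _ : Bond d (towerP L m (n + 1)) => c₀) W f b‖ ≤ F),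
        (∀ x : TSite d (towerP L m (n + 1)), ‖WL2.equiv ℂ (fun _ : TSite d (towerP L m (n + 1)) => c₀) W (RofUk L m n φ η U (GpOfUk L m n φ η U a' (c₁ := c₁) hpos' (covDivL2K ℂ c₀ ((η : ℂ))⁻¹ (adTransportW φ fun bb => (U bb)⁻¹) f))) x‖ ≤ Ba * Real.exp (-(δa * tdist m (blockCoord (L ^ (n + 1)) m (siteCast (towerP_eq_fineP_pow L m (n + 1)) x)) v)) * F) ∧
        (∀ x x' : TSite d (towerP L m (n + 1)), tdist (towerP L m (n + 1)) x x' ≤ (L : ℝ) ^ (n + 1) →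
          ‖WL2.equiv ℂ (fun _ : TSite d (towerP L m (n + 1)) => c₀) W (RofUk L m n φ η U (GpOfUk L m n φ η U a' (c₁ := c₁) hpos' (covDivL2K ℂ c₀ ((η : ℂ))⁻¹ (adTransportW φ fun bb => (U bb)⁻¹) f))) x' - WL2.equiv ℂ (fun _ : TSite d (towerP L m (n + 1)) => c₀) W (RofUk L m n φ η U (GpOfUk L m n φ η U a' (c₁ := c₁) hpos' (covDivL2K ℂ c₀ ((η : ℂ))⁻¹ (adTransportW φ fun bb => (U bb)⁻¹) f))) x‖ ≤
            Ba * Real.exp (-(δa * tdist m (blockCoord (L ^ (n + 1)) m (siteCast (towerP_eq_fineP_pow L m (n + 1)) x)) v)) * (tdist (towerP L m (n + 1)) x x' / (L : ℝ) ^ (n + 1)) ^ ((1 : ℝ) / 2) * F) ∧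
        (∀ x : TSite d (towerP L m (n + 1)), ‖WL2.equiv ℂ (fun _ : TSite d (towerP L m (n + 1)) => c₀) W (GpOfUk L m n φ η U a' (c₁ := c₁) hpos' (RofUk L m n φ η U (GpOfUk L m n φ η U a' (c₁ := c₁) hpos' (covDivL2K ℂ c₀ ((η : ℂ))⁻¹ (adTransportW φ fun bb => (U bb)⁻¹) f)))) x‖ ≤ Ba * Real.exp (-(δa * tdist m (blockCoord (L ^ (n + 1)) m (siteCast (towerP_eq_fineP_pow L m (n + 1)) x)) v)) * F) ∧
        (∀ bb : Bond d (towerP L m (n + 1)), ‖WL2.equiv ℂ (fun _ : Bond d (towerP L m (n + 1)) => c₀) W (covDerivL2K ℂ c₀ ((η : ℂ))⁻¹ (adTransportW φ U) (GpOfUk L m n φ η U a' (c₁ := c₁) hpos' (RofUk L m n φ η U (GpOfUk L m n φ η U a' (c₁ := c₁) hpos' (covDivL2K ℂ c₀ ((η : ℂ))⁻¹ (adTransportW φ fun bb => (U bb)⁻¹) f))))) bb‖ ≤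
          Ba * Real.exp (-(δa * tdist m (blockCoord (L ^ (n + 1)) m (siteCast (towerP_eq_fineP_pow L m (n + 1)) (bpos bb))) v)) * F) := by
  classical
  have hL2 : 2 ≤ L := le_trans (by norm_num) hL3
  -- (R1)/(R2) for `G′_kD*_Uf`, exponent ½ explicit
  obtain ⟨αv, Bv, δv, hαv, hBv, hδv, HV⟩ := exists_valueRow_GpOfUk_covDiv L hL3 φ hMφ hMφ' hφ hφ' ha' hϱ0 hϱ1 τ hτ₂ hφτ hd
  obtain ⟨Cloc, hCloc, hloc⟩ := exists_localHolder_flat (d := d) L (W := W)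
  have HflatW := flatWindowLetter_of_localHolder (d := d) L (W := W) hL2 Cloc hloc
  obtain ⟨αh, Bh, δh, hαh, hBh, hδh, HH⟩ := exists_holderRow_GpOfUk_covDiv_of_flatWindow L hL3 φ hMφ hMφ' hφ hφ' ha' hϱ0 hϱ1 τ hτ₂ hφτ hd
    (β := (1 : ℝ) / 2) (by norm_num) (by norm_num) (Cloc * (16 * (d : ℝ) + 1) * Real.exp (4 * (d : ℝ))) (by positivity) HflatW
  -- (HLa₀) with exponent ½
  have HLa0 : ∃ αa Ba δa : ℝ, 0 < αa ∧ 0 ≤ Ba ∧ 0 < δa ∧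
      ∀ (n : ℕ) (η : ℝ) (_hηL : η * (L : ℝ) ^ (n + 1) = 1) (c₀ c₁ : ℝ) [Fact (0 < c₀)] [Fact (0 < c₁)]
        (_hw : c₀ * ((L : ℝ) ^ (n + 1)) ^ d = c₁) (_hρ : |η| ^ d / c₀ ≤ ρw) (m : Fin d → ℕ) [∀ i, NeZero (m i)] (_hm : ∀ i, 1 ≤ m i)
        (U : Bond d (towerP L m (n + 1)) → 𝔸ˣ) (αU : ℕ → ℝ) (_hα0 : ∀ j, 0 ≤ αU j) (hα1 : ∀ j, αU j ≤ 1 / 64)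
        (hU1 : ∀ (j : ℕ) (x : B7Prop1Explicit.Site d) (k : Fin d), perCfg (towerP L m (j + 1)) (UlevOf L m (n + 1) U j) x k ∈ U1 𝔸)
        (hreg : ∀ (j : ℕ) (y : TSite d (towerP L m j)) (k : Fin d) (ρ' : Fin d → Fin L),
          ‖((Wcx L (perCfg (towerP L m (j + 1)) (UlevOf L m (n + 1) U j)) (cornerSite L y) k (boxVec L ρ') : 𝔸ˣ) : 𝔸) - 1‖ ≤ αU j)
        (εU : ℕ → ℝ) (_hεU : ∀ j, 0 ≤ εU j) (_hUε : ∀ (j : ℕ) (b : Bond d (towerP L m (j + 1))), ‖(UlevOf L m (n + 1) U j b : 𝔸) - 1‖ ≤ εU j)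
        (_hLb : ∀ (j : ℕ) (b : Bond d (towerP L m (j + 1))), UlevOf L m (n + 1) U j b ∈ U1 𝔸)
        (α : ℝ) (_hα : 0 ≤ α) (_hαle : α ≤ αa)
        (hUst : ∀ b, star (U b : 𝔸) = (((U b)⁻¹ : 𝔸ˣ) : 𝔸)) (_hUb : ∀ b, U b ∈ U1 𝔸) (_hUη : ∀ b, ‖(U b : 𝔸) - 1‖ ≤ α * η)
        (_hpl : ∀ p : B9SectCLatticeCarrier.Plaq d (towerP L m (n + 1)), ‖(plaqHolU U p : 𝔸) - 1‖ ≤ α * η ^ 2)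
        (_hUgrad : ∀ (x : TSite d (towerP L m (n + 1))) (μ : Fin d), ‖(U (x, μ) : 𝔸) - U (unshift μ x, μ)‖ ≤ α * η ^ 2)
        (_hRlev : ∀ (j : ℕ) (b : Bond d (towerP L m (j + 1))) (w : W), ‖adTransportW φ (UlevOf L m (n + 1) U j) b w‖ ≤ ‖w‖)
        (_hεg : ∀ j < n + 1, εU j ≤ α * ϱ ^ j) (_hAQ : ∑ j ∈ Finset.range (n + 1), αU j ≤ AQ)
        (hpos' : ∀ x : SiteL2K ℂ d (towerP L m (n + 1)) c₀ W, x ≠ 0 → 0 < RCLike.re ⟪x, laplacePrimeAk L m n φ η U a' (c₁ := c₁) x⟫_ℂ)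
        (hpos : ∀ x : BondL2K ℂ d (towerP L m (n + 1)) c₀ W, x ≠ 0 →
          0 < RCLike.re ⟪x, laplaceAk L m n φ η U hL αU hα1 hU1 hreg τ (c₀ := c₀) (c₁ := c₁) a x⟫_ℂ)
        (hposπ : ∀ x : BondL2K ℂ d (towerP L m (n + 1)) c₀ W, x ≠ 0 →
          0 < RCLike.re ⟪x, laplaceAkPi L m n φ τ η U a' hpos' hL αU hα1 hU1 hreg (c₁ := c₁) a x⟫_ℂ)
        (_hc₀ : c₀ = η ^ d)
        (_hJ : ∀ (μ : Fin d) (y : TSite d (towerP L m (n + 1))),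
          ‖B9Eq39Adjoint.J (fun μ => B9Eq33CovDerivVector.shiftEquiv μ) (fun μ y => U (y, μ)) η μ y‖ ≤ α)
        (v : TSite d m) (f : BondL2K ℂ d (towerP L m (n + 1)) c₀ W) (F : ℝ)
        (_hfv : ∀ b, blockCoord (L ^ (n + 1)) m (siteCast (towerP_eq_fineP_pow L m (n + 1)) (bpos b)) ≠ v →
          WL2.equiv ℂ (fun _ : Bond d (towerP L m (n + 1)) => c₀) W f b = 0)
        (_hfF : ∀ b, ‖WL2.equiv ℂ (fun _ : Bond d (towerP L m (n + 1)) => c₀) W f b‖ ≤ F) (x : TSite d (towerP L m (n + 1))),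
        ‖WL2.equiv ℂ (fun _ : TSite d (towerP L m (n + 1)) => c₀) W (GpOfUk L m n φ η U a' (c₁ := c₁) hpos' (covDivL2K ℂ c₀ ((η : ℂ))⁻¹ (adTransportW φ fun bb => (U bb)⁻¹) f)) x‖ ≤
          Ba * Real.exp (-(δa * tdist m (blockCoord (L ^ (n + 1)) m (siteCast (towerP_eq_fineP_pow L m (n + 1)) x)) v)) * F ∧
        ∀ x' : TSite d (towerP L m (n + 1)), tdist (towerP L m (n + 1)) x x' ≤ ((L ^ (n + 1) : ℕ) : ℝ) →
          ‖WL2.equiv ℂ (fun _ : TSite d (towerP L m (n + 1)) => c₀) W (GpOfUk L m n φ η U a' (c₁ := c₁) hpos' (covDivL2K ℂ c₀ ((η : ℂ))⁻¹ (adTransportW φ fun bb => (U bb)⁻¹) f)) x' - WL2.equiv ℂ (fun _ : TSite d (towerP L m (n + 1)) => c₀) W (GpOfUk L m n φ η U a' (c₁ := c₁) hpos' (covDivL2K ℂ c₀ ((η : ℂ))⁻¹ (adTransportW φ fun bb => (U bb)⁻¹) f)) x‖ ≤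
            Ba * Real.exp (-(δa * tdist m (blockCoord (L ^ (n + 1)) m (siteCast (towerP_eq_fineP_pow L m (n + 1)) x)) v)) * (tdist (towerP L m (n + 1)) x x' / ((L ^ (n + 1) : ℕ) : ℝ)) ^ ((1 : ℝ) / 2) * F := by
    refine ⟨min αv αh, max Bv Bh, min δv δh, lt_min hαv hαh, le_max_of_le_left hBv, lt_min hδv hδh, ?_⟩
    intro n η hηL c₀ c₁ _ _ hw _ m _ _ U αU _ hα1 hU1 hreg εU hεU hUε hLb α hα hαle hUst hUb hUη _ hUgrad hRlev hεg _ hpos' _ _ _ _ v f F hfv hfF x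
    have hF : 0 ≤ F := (norm_nonneg _).trans (hfF (x, ⟨0, hd⟩))
    set D : ℝ := tdist m (blockCoord (L ^ (n + 1)) m (siteCast (towerP_eq_fineP_pow L m (n + 1)) x)) v with hD
    have hD0 : 0 ≤ D := tdist_nonneg m _ _
    have hBmax : 0 ≤ max Bv Bh := le_max_of_le_left hBv
    have hev : Bv * Real.exp (-(δv * D)) ≤ max Bv Bh * Real.exp (-(min δv δh * D)) :=
      mul_le_mul (le_max_left _ _) (Real.exp_le_exp.2 (neg_le_neg (mul_le_mul_of_nonneg_right (min_le_left δv δh) hD0))) (Real.exp_pos _).le hBmax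
    have heh : Bh * Real.exp (-(δh * D)) ≤ max Bv Bh * Real.exp (-(min δv δh * D)) :=
      mul_le_mul (le_max_right _ _) (Real.exp_le_exp.2 (neg_le_neg (mul_le_mul_of_nonneg_right (min_le_right δv δh) hD0))) (Real.exp_pos _).le hBmax
    refine ⟨?_, fun x' hxx => ?_⟩
    · have h := HV n η hηL c₀ c₁ hw m U α hα (hαle.trans (min_le_left _ _)) hUb hUη hUgrad εU hεU hεg hUε hLb hUst hRlev hpos' v f F hfv hfF x
      exact h.trans (mul_le_mul_of_nonneg_right hev hF)
    · rw [Nat.cast_pow] at hxx ⊢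
      have h := HH n η hηL c₀ c₁ hw m U α hα (hαle.trans (min_le_right _ _)) hUb hUη hUgrad εU hεU hεg hUε hLb hUst hRlev hpos' v f F hfv hfF x x' hxx
      have hq : 0 ≤ (tdist (towerP L m (n + 1)) x x' / (L : ℝ) ^ (n + 1)) ^ ((1 : ℝ) / 2) * F :=
        mul_nonneg (Real.rpow_nonneg (div_nonneg (tdist_nonneg _ _ _) (by positivity)) _) hF
      calc _ ≤ Bh * Real.exp (-(δh * D)) * (tdist (towerP L m (n + 1)) x x' / (L : ℝ) ^ (n + 1)) ^ ((1 : ℝ) / 2) * F := h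
        _ = Bh * Real.exp (-(δh * D)) * ((tdist (towerP L m (n + 1)) x x' / (L : ℝ) ^ (n + 1)) ^ ((1 : ℝ) / 2) * F) := by ring
        _ ≤ max Bv Bh * Real.exp (-(min δv δh * D)) * ((tdist (towerP L m (n + 1)) x x' / (L : ℝ) ^ (n + 1)) ^ ((1 : ℝ) / 2) * F) :=
            mul_le_mul_of_nonneg_right heh hq
        _ = _ := by ring
  -- the `R_k`-step, exponent ½ explicit
  obtain ⟨αa, Ba, δa, hαa, hBa, hδa, HA⟩ := holderLetter_RkGpDstar_of_GpDstar_explicit L hL φ hMφ hMφ' hφ hφ' τ hτ₂ hφτ AQ (ε := (1 : ℝ) / 2) (by norm_num)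
    HLa0 (HX_holds hd L hL hL3 φ hMφ hMφ' hφ hφ' ha ha' hϱ0 hϱ1 τ hτ hCτ hMτ hρw hτ₁ hτ₂ hφτ AQ)
  -- (R3)/(R4)
  obtain ⟨αr, Br, κr, hαr, hBr, hκr, HRk⟩ := exists_rows_GpOfUk_of_decaying L hL3 φ hMφ hMφ' hφ hφ' ha' hϱ0 hϱ1 τ hτ₂ hφτ hd
  set δ' : ℝ := min δa κr with hδ'
  have hδ'0 : 0 < δ' := lt_min hδa hκr
  have hδ'a : δ' ≤ δa := min_le_left _ _
  have hδ'r : δ' ≤ κr := min_le_right _ _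
  have hKc : 0 ≤ latticeConst d (2 * κr - δ') := latticeConst_nonneg d (by linarith)
  refine ⟨min αa αr, max Ba (Br * latticeConst d (2 * κr - δ') * Ba), δ', lt_min hαa hαr, le_max_of_le_left hBa, hδ'0, ?_⟩
  intro n η hηL c₀ c₁ _ _ hw hρ m _ hm U αU hα0 hα1 hU1 hreg εU hεU hUε hLb α hα hαle hUst hUb hUη hpl hUgrad hRlev hεg hAQ hpos' hpos hposπ hc₀ hJ v f F hfv hfF
  have hαa' : α ≤ αa := hαle.trans (min_le_left _ _)
  have hαr' : α ≤ αr := hαle.trans (min_le_right _ _)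
  have HAk := HA n η hηL c₀ c₁ hw hρ m hm U αU hα0 hα1 hU1 hreg εU hεU hUε hLb α hα hαa' hUst hUb hUη hpl hUgrad hRlev hεg hAQ hpos' hpos hposπ hc₀ hJ v f F hfv hfF
  have hF : 0 ≤ F := (norm_nonneg _).trans (hfF ((fun _ => 0), ⟨0, hd⟩))
  have hBmax : Ba ≤ max Ba (Br * latticeConst d (2 * κr - δ') * Ba) := le_max_left _ _
  have hB0 : 0 ≤ max Ba (Br * latticeConst d (2 * κr - δ') * Ba) := le_max_of_le_left hBa
  -- weakening of the rate `δa ↦ δ′`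
  have hwk : ∀ x : TSite d (towerP L m (n + 1)),
      Ba * Real.exp (-(δa * tdist m (blockCoord (L ^ (n + 1)) m (siteCast (towerP_eq_fineP_pow L m (n + 1)) x)) v)) ≤
        max Ba (Br * latticeConst d (2 * κr - δ') * Ba) * Real.exp (-(δ' * tdist m (blockCoord (L ^ (n + 1)) m (siteCast (towerP_eq_fineP_pow L m (n + 1)) x)) v)) :=
    fun x => mul_le_mul hBmax (Real.exp_le_exp.2 (neg_le_neg (mul_le_mul_of_nonneg_right hδ'a (tdist_nonneg m _ _)))) (Real.exp_pos _).le hB0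
  have hωδ : ∀ x : TSite d (towerP L m (n + 1)),
      ‖WL2.equiv ℂ (fun _ : TSite d (towerP L m (n + 1)) => c₀) W (RofUk L m n φ η U (GpOfUk L m n φ η U a' (c₁ := c₁) hpos'
        (covDivL2K ℂ c₀ ((η : ℂ))⁻¹ (adTransportW φ fun bb => (U bb)⁻¹) f))) x‖ ≤
        Ba * F * Real.exp (-(δ' * tdist m (blockCoord (L ^ (n + 1)) m (siteCast (towerP_eq_fineP_pow L m (n + 1)) x)) v)) := by
    intro x
    calc _ ≤ Ba * Real.exp (-(δa * tdist m (blockCoord (L ^ (n + 1)) m (siteCast (towerP_eq_fineP_pow L m (n + 1)) x)) v)) * F := (HAk x).1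
      _ ≤ Ba * Real.exp (-(δ' * tdist m (blockCoord (L ^ (n + 1)) m (siteCast (towerP_eq_fineP_pow L m (n + 1)) x)) v)) * F :=
          mul_le_mul_of_nonneg_right (mul_le_mul_of_nonneg_left
            (Real.exp_le_exp.2 (neg_le_neg (mul_le_mul_of_nonneg_right hδ'a (tdist_nonneg m _ _)))) hBa) hF
      _ = _ := mul_right_comm _ _ _
  obtain ⟨HR3, HR4⟩ := HRk n η hηL c₀ c₁ hw m U α hα hαr' hUb hUη hUgrad εU hεU hεg hUε hLb hUst hRlev hpos' v _ (Ba * F) δ' (mul_nonneg hBa hF) hδ'0 hδ'r hωδ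
  refine ⟨fun x => (HAk x).1.trans (mul_le_mul_of_nonneg_right (hwk x) hF), fun x x' hxx => ?_, fun x => (HR3 x).trans ?_, fun bb => (HR4 bb).trans ?_⟩
  · have hxx' : tdist (towerP L m (n + 1)) x x' ≤ ((L ^ (n + 1) : ℕ) : ℝ) := by rw [Nat.cast_pow]; exact hxx
    have h := (HAk x).2 x' hxx'
    rw [Nat.cast_pow] at h
    have hq : 0 ≤ (tdist (towerP L m (n + 1)) x x' / (L : ℝ) ^ (n + 1)) ^ ((1 : ℝ) / 2) * F :=
      mul_nonneg (Real.rpow_nonneg (div_nonneg (tdist_nonneg _ _ _) (by positivity)) _) hF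
    calc _ ≤ Ba * Real.exp (-(δa * tdist m (blockCoord (L ^ (n + 1)) m (siteCast (towerP_eq_fineP_pow L m (n + 1)) x)) v)) *
          (tdist (towerP L m (n + 1)) x x' / (L : ℝ) ^ (n + 1)) ^ ((1 : ℝ) / 2) * F := h
      _ = Ba * Real.exp (-(δa * tdist m (blockCoord (L ^ (n + 1)) m (siteCast (towerP_eq_fineP_pow L m (n + 1)) x)) v)) *
          ((tdist (towerP L m (n + 1)) x x' / (L : ℝ) ^ (n + 1)) ^ ((1 : ℝ) / 2) * F) := by ring
      _ ≤ max Ba (Br * latticeConst d (2 * κr - δ') * Ba) * Real.exp (-(δ' * tdist m (blockCoord (L ^ (n + 1)) m (siteCast (towerP_eq_fineP_pow L m (n + 1)) x)) v)) *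
          ((tdist (towerP L m (n + 1)) x x' / (L : ℝ) ^ (n + 1)) ^ ((1 : ℝ) / 2) * F) := mul_le_mul_of_nonneg_right (hwk x) hq
      _ = _ := by ring
  · have hE := (Real.exp_pos (-(δ' * tdist m (blockCoord (L ^ (n + 1)) m (siteCast (towerP_eq_fineP_pow L m (n + 1)) x)) v))).le
    calc Br * latticeConst d (2 * κr - δ') * (Ba * F) * Real.exp (-(δ' * tdist m (blockCoord (L ^ (n + 1)) m (siteCast (towerP_eq_fineP_pow L m (n + 1)) x)) v))
        = (Br * latticeConst d (2 * κr - δ') * Ba) * Real.exp (-(δ' * tdist m (blockCoord (L ^ (n + 1)) m (siteCast (towerP_eq_fineP_pow L m (n + 1)) x)) v)) * F := by ring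
      _ ≤ _ := mul_le_mul_of_nonneg_right (mul_le_mul_of_nonneg_right (le_max_right _ _) hE) hF
  · have hE := (Real.exp_pos (-(δ' * tdist m (blockCoord (L ^ (n + 1)) m (siteCast (towerP_eq_fineP_pow L m (n + 1)) (bpos bb))) v))).le
    calc Br * latticeConst d (2 * κr - δ') * (Ba * F) * Real.exp (-(δ' * tdist m (blockCoord (L ^ (n + 1)) m (siteCast (towerP_eq_fineP_pow L m (n + 1)) (bpos bb))) v))
        = (Br * latticeConst d (2 * κr - δ') * Ba) * Real.exp (-(δ' * tdist m (blockCoord (L ^ (n + 1)) m (siteCast (towerP_eq_fineP_pow L m (n + 1)) (bpos bb))) v)) * F := by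
          ring
      _ ≤ _ := mul_le_mul_of_nonneg_right (mul_le_mul_of_nonneg_right (le_max_right _ _) hE) hF

/-! ## §2 `H3` on the model -/

set_option maxHeartbeats 800000 in -- two ≈ 50-binder blocks
include hd hL hL3 hMφ hMφ' hφ hφ' ha ha' hϱ0 hϱ1 hτ hCτ hMτ hρw hτ₁ hτ₂ hφτ in
/-- **`H3` ON THE MODEL — the third word's local slice-gradient row with NO displayed letter**: `rows_RkGpDstar_GpOfUk_hold` docked into the junction
`B9Eq3152ThirdWordGradRowOfHessianRows.exists_local_gradLetter_thirdWord_of_rows`. [cite: Balaban1985BackgroundPropagators, Thm 3.13 p.426, (3.152)–(3.153) p.426, Thm 3.1 (3.44) p.398] -/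
theorem local_gradLetter_thirdWord_holds :
    ∃ α₃ B₃ δ₃ : ℝ, 0 < α₃ ∧ 0 ≤ B₃ ∧ 0 < δ₃ ∧
      ∀ (n : ℕ) (η : ℝ) (_hηL : η * (L : ℝ) ^ (n + 1) = 1) (c₀ c₁ : ℝ) [Fact (0 < c₀)] [Fact (0 < c₁)]
        (_hw : c₀ * ((L : ℝ) ^ (n + 1)) ^ d = c₁) (_hρ : |η| ^ d / c₀ ≤ ρw) (m : Fin d → ℕ) [∀ i, NeZero (m i)] (_hm : ∀ i, 1 ≤ m i)
        (U : Bond d (towerP L m (n + 1)) → 𝔸ˣ) (αU : ℕ → ℝ) (_hα0 : ∀ j, 0 ≤ αU j) (hα1 : ∀ j, αU j ≤ 1 / 64)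
        (hU1 : ∀ (j : ℕ) (x : B7Prop1Explicit.Site d) (k : Fin d), perCfg (towerP L m (j + 1)) (UlevOf L m (n + 1) U j) x k ∈ U1 𝔸)
        (hreg : ∀ (j : ℕ) (y : TSite d (towerP L m j)) (k : Fin d) (ρ' : Fin d → Fin L),
          ‖((Wcx L (perCfg (towerP L m (j + 1)) (UlevOf L m (n + 1) U j)) (cornerSite L y) k (boxVec L ρ') : 𝔸ˣ) : 𝔸) - 1‖ ≤ αU j)
        (εU : ℕ → ℝ) (_hεU : ∀ j, 0 ≤ εU j) (_hUε : ∀ (j : ℕ) (b : Bond d (towerP L m (j + 1))), ‖(UlevOf L m (n + 1) U j b : 𝔸) - 1‖ ≤ εU j)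
        (_hLb : ∀ (j : ℕ) (b : Bond d (towerP L m (j + 1))), UlevOf L m (n + 1) U j b ∈ U1 𝔸)
        (α : ℝ) (_hα : 0 ≤ α) (_hαle : α ≤ α₃)
        (hUst : ∀ b, star (U b : 𝔸) = (((U b)⁻¹ : 𝔸ˣ) : 𝔸)) (_hUb : ∀ b, U b ∈ U1 𝔸) (_hUη : ∀ b, ‖(U b : 𝔸) - 1‖ ≤ α * η)
        (_hpl : ∀ p : B9SectCLatticeCarrier.Plaq d (towerP L m (n + 1)), ‖(plaqHolU U p : 𝔸) - 1‖ ≤ α * η ^ 2)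
        (_hUgrad : ∀ (x : TSite d (towerP L m (n + 1))) (μ : Fin d), ‖(U (x, μ) : 𝔸) - U (unshift μ x, μ)‖ ≤ α * η ^ 2)
        (_hRlev : ∀ (j : ℕ) (b : Bond d (towerP L m (j + 1))) (w : W), ‖adTransportW φ (UlevOf L m (n + 1) U j) b w‖ ≤ ‖w‖)
        (_hεg : ∀ j < n + 1, εU j ≤ α * ϱ ^ j) (_hAQ : ∑ j ∈ Finset.range (n + 1), αU j ≤ AQ)
        (hpos' : ∀ x : SiteL2K ℂ d (towerP L m (n + 1)) c₀ W, x ≠ 0 → 0 < RCLike.re ⟪x, laplacePrimeAk L m n φ η U a' (c₁ := c₁) x⟫_ℂ)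
        (hpos : ∀ x : BondL2K ℂ d (towerP L m (n + 1)) c₀ W, x ≠ 0 →
          0 < RCLike.re ⟪x, laplaceAk L m n φ η U hL αU hα1 hU1 hreg τ (c₀ := c₀) (c₁ := c₁) a x⟫_ℂ)
        (hposπ : ∀ x : BondL2K ℂ d (towerP L m (n + 1)) c₀ W, x ≠ 0 →
          0 < RCLike.re ⟪x, laplaceAkPi L m n φ τ η U a' hpos' hL αU hα1 hU1 hreg (c₁ := c₁) a x⟫_ℂ)
        (_hc₀ : c₀ = η ^ d)
        (_hJ : ∀ (μ : Fin d) (y : TSite d (towerP L m (n + 1))),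
          ‖B9Eq39Adjoint.J (fun μ => B9Eq33CovDerivVector.shiftEquiv μ) (fun μ y => U (y, μ)) η μ y‖ ≤ α)
        (v : TSite d m) (f : BondL2K ℂ d (towerP L m (n + 1)) c₀ W) (F : ℝ)
        (_hfv : ∀ b, blockCoord (L ^ (n + 1)) m (siteCast (towerP_eq_fineP_pow L m (n + 1)) (bpos b)) ≠ v →
          WL2.equiv ℂ (fun _ : Bond d (towerP L m (n + 1)) => c₀) W f b = 0)
        (_hfF : ∀ b, ‖WL2.equiv ℂ (fun _ : Bond d (towerP L m (n + 1)) => c₀) W f b‖ ≤ F) (μ : Fin d) (b : Bond d (towerP L m (n + 1))),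
        ‖WL2.equiv ℂ (fun _ : Bond d (towerP L m (n + 1)) => c₀) W (covDerivL2K ℂ c₀ ((η : ℂ))⁻¹ (adTransportW φ U)
            ((WL2.equiv ℂ (fun _ : TSite d (towerP L m (n + 1)) => c₀) W).symm fun y =>
              WL2.equiv ℂ (fun _ : Bond d (towerP L m (n + 1)) => c₀) W
                (G1LatticeK hposπ (covDerivL2K ℂ c₀ ((η : ℂ))⁻¹ (adTransportW φ U) (RofUk L m n φ η U
                  (covDivL2K ℂ c₀ ((η : ℂ))⁻¹ (adTransportW φ fun bb => (U bb)⁻¹) (G1LatticeK hposπ f))))) (y, μ))) b‖ ≤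
          B₃ * Real.exp (-(δ₃ * tdist m (blockCoord (L ^ (n + 1)) m (siteCast (towerP_eq_fineP_pow L m (n + 1)) (bpos b))) v)) * F :=
  exists_local_gradLetter_thirdWord_of_rows L hL hL3 φ hMφ hMφ' hφ hφ' ha' hϱ0 hϱ1 τ hτ₁ hτ₂ hφτ AQ hd
    (rows_RkGpDstar_GpOfUk_hold hd L hL hL3 φ hMφ hMφ' hφ hφ' ha ha' hϱ0 hϱ1 τ hτ hCτ hMτ hρw hτ₁ hτ₂ hφτ AQ)

/-! ## §3 The (117) socket for the FULL `𝔊̃_k` on the model -/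

set_option maxHeartbeats 800000 in -- two ≈ 50-binder blocks
include hd hL hL3 hMφ hMφ' hφ hφ' hstar ha ha' hϱ0 hϱ1 hτ hCτ hτm hMτ hρw hτ₁ hτ₂ hφτ in
/-- **STOREY H CLOSED ON THE MODEL: the (117) socket `‖toCLM115 ∇_U 𝔊̃_k‖ ≤ max(w̄₀B, w̄₁B)·w̲⁻¹` for the FULL `𝔊̃_k`, NO displayed letter** — G-3
`B11Eq117FrakGkPiTransformationNorm.exists_norm_toCLM115_frakGkPi_le_of_thirdWord` at `local_gradLetter_thirdWord_holds`.
[cite: Balaban1985Variational, (117) p.296; Balaban1985BackgroundPropagators, Thm 3.13 p.426, Thm 3.1 (3.42)–(3.44) pp.397–398, (3.36) p.396] -/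
theorem norm_toCLM115_frakGkPi_le :
    ∃ α₁ j₁ B : ℝ, 0 < α₁ ∧ 0 < j₁ ∧ 0 ≤ B ∧
      ∀ (n : ℕ) (η : ℝ) (_hηL : η * (L : ℝ) ^ (n + 1) = 1) (c₀ c₁ : ℝ) [Fact (0 < c₀)] [Fact (0 < c₁)]
        (_hw : c₀ * ((L : ℝ) ^ (n + 1)) ^ d = c₁) (_hρ : |η| ^ d / c₀ ≤ ρw) (m : Fin d → ℕ) [∀ i, NeZero (m i)] (_hm : ∀ i, 1 ≤ m i)
        (U : Bond d (towerP L m (n + 1)) → 𝔸ˣ) (αU : ℕ → ℝ) (_hα0 : ∀ j, 0 ≤ αU j) (hα1 : ∀ j, αU j ≤ 1 / 64)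
        (hαL : ∀ j, 50 * (d + 1) * αU j * (L : ℝ) ^ d ≤ 1 / 2)
        (hU1 : ∀ (j : ℕ) (x : B7Prop1Explicit.Site d) (k : Fin d), perCfg (towerP L m (j + 1)) (UlevOf L m (n + 1) U j) x k ∈ U1 𝔸)
        (hreg : ∀ (j : ℕ) (y : TSite d (towerP L m j)) (k : Fin d) (ρ' : Fin d → Fin L),
          ‖((Wcx L (perCfg (towerP L m (j + 1)) (UlevOf L m (n + 1) U j)) (cornerSite L y) k (boxVec L ρ') : 𝔸ˣ) : 𝔸) - 1‖ ≤ αU j)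
        (εU : ℕ → ℝ) (_hεU : ∀ j, 0 ≤ εU j) (_hUε : ∀ (j : ℕ) (b : Bond d (towerP L m (j + 1))), ‖(UlevOf L m (n + 1) U j b : 𝔸) - 1‖ ≤ εU j)
        (_hLb : ∀ (j : ℕ) (b : Bond d (towerP L m (j + 1))), UlevOf L m (n + 1) U j b ∈ U1 𝔸)
        (α : ℝ) (_hα : 0 ≤ α) (_hαle : α ≤ α₁)
        (hUst : ∀ b, star (U b : 𝔸) = (((U b)⁻¹ : 𝔸ˣ) : 𝔸)) (_hUb : ∀ b, U b ∈ U1 𝔸) (_hUη : ∀ b, ‖(U b : 𝔸) - 1‖ ≤ α * η)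
        (_hpl : ∀ p : B9SectCLatticeCarrier.Plaq d (towerP L m (n + 1)), ‖(plaqHolU U p : 𝔸) - 1‖ ≤ α * η ^ 2)
        (_hUgrad : ∀ (x : TSite d (towerP L m (n + 1))) (μ : Fin d), ‖(U (x, μ) : 𝔸) - U (unshift μ x, μ)‖ ≤ α * η ^ 2)
        (_hRlev : ∀ (j : ℕ) (b : Bond d (towerP L m (j + 1))) (w : W), ‖adTransportW φ (UlevOf L m (n + 1) U j) b w‖ ≤ ‖w‖)
        (_hεg : ∀ j < n + 1, εU j ≤ α * ϱ ^ j) (_hAQ : ∑ j ∈ Finset.range (n + 1), αU j ≤ AQ)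
        (hpos' : ∀ x : SiteL2K ℂ d (towerP L m (n + 1)) c₀ W, x ≠ 0 → 0 < RCLike.re ⟪x, laplacePrimeAk L m n φ η U a' (c₁ := c₁) x⟫_ℂ)
        (hpos : ∀ x : BondL2K ℂ d (towerP L m (n + 1)) c₀ W, x ≠ 0 →
          0 < RCLike.re ⟪x, laplaceAk L m n φ η U hL αU hα1 hU1 hreg τ (c₀ := c₀) (c₁ := c₁) a x⟫_ℂ)
        (_hc₀η : c₀ = η ^ d) (j₀ : ℝ) (_hJ : ∀ μ y, ‖B9Eq39Adjoint.J (fun μ => B9Eq33CovDerivVector.shiftEquiv μ) (fun μ y => U (y, μ)) η μ y‖ ≤ j₀) (_hj : j₀ ≤ j₁)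
        (hposπ : ∀ x : BondL2K ℂ d (towerP L m (n + 1)) c₀ W, x ≠ 0 →
          0 < RCLike.re ⟪x, laplaceAkPi L m n φ τ η U a' hpos' hL αU hα1 hU1 hreg (c₁ := c₁) a x⟫_ℂ)
        (hQ : Function.Surjective (QkW L m n φ U hL αU hα1 hU1 hreg (c₀ := c₀) (c₁ := c₁)))
        (Lw ηw : ℝ) [Fact (0 < Lw)] [Fact (0 < ηw)] (lev₀ : Bond d (towerP L m (n + 1)) → ℕ) (lev₁ : Bond d (towerP L m (n + 1)) × Fin d → ℕ),
        ‖toCLM115 (L := Lw) (η := ηw) (lev₀ := lev₀) lev₁ (covGrad ((η : ℂ))⁻¹ (adTransportW φ U))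
            ((WL2.linearEquiv ℂ ℂ (fun _ : Bond d (towerP L m (n + 1)) => c₀)).toLinearMap ∘ₗ (frakGLatticeK hposπ hQ : _ →ₗ[ℂ] _) ∘ₗ
              ((WL2.linearEquiv ℂ ℂ (fun _ : Bond d (towerP L m (n + 1)) => c₀)).symm.toLinearMap :
                (Bond d (towerP L m (n + 1)) → W) →ₗ[ℂ] BondL2K ℂ d (towerP L m (n + 1)) c₀ W))‖ ≤
          max ((NegSup.wSup (levWeight Lw ηw lev₀ 1) : ℝ) * B) (NegSup.wSup (levWeight Lw ηw lev₁ 2) * B) *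
            NegSup.wInvSup (levWeight Lw ηw lev₀ 3) :=
  exists_norm_toCLM115_frakGkPi_le_of_thirdWord hd L hL hL3 φ hMφ hMφ' hφ hφ' hstar ha ha' hϱ0 hϱ1 τ hτ hCτ hτm hMτ hρw hτ₁ hτ₂ hφτ AQ
    (local_gradLetter_thirdWord_holds hd L hL hL3 φ hMφ hMφ' hφ hφ' ha ha' hϱ0 hϱ1 τ hτ hCτ hMτ hρw hτ₁ hτ₂ hφτ AQ)

end Literature.MathematicalPhysics.QuantumFieldTheory.Balaban1983to89.B9Eq3152StoreyHClosedOnModel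

end
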